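import Mathlib
import HarnessLib
import Summits.Langlands.Langlands.Theorems.EisensteinGelfandKirillovProModularOfGKBoundStubHostTraceAlgebra

/-!
# Route `EisensteinGelfandKirillov`, crux `ProModularOfGKBound` (stmt-Langlands-18273), line `two-leaf-fern`:
# the trace algebra of the lifts of `ρ`, part 2 — LOCALITY (`stub_traceHostLocal`)

Continuation of `…StubHostTraceAlgebra.lean` (the compact trace algebra `R_tr ⊆ ∏_{ρ'} ℚ̄_p` with its
pseudocharacter `T`).  Here: `R_tr` is a LOCAL ring and `p` lies in its maximal ideal.  The reduction
`r ↦ (r_{ρ'} mod 𝔪_O) ∈ O/𝔪_O` (`residueAt`) is a ring homomorphism, locally constant in `r`, and on the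
generators `T(g)` independent of the coordinate `ρ'` (trace congruence `tr ρ'₀ ≡ tr ρ₀`); since the generators are
dense (G) it is independent of `ρ'` on all of `R_tr` (`residueAt_eq`).  Hence `residueAt r ≠ 0` iff EVERY coordinate
of `r` is a unit of `O`, and such an `r` is a unit of `R_tr` (`isUnit_of_forall_norm_eq_one`): the closure of
`{rⁿ : n ≥ 1}` in the compact `R_tr` is a compact semigroup, so contains an idempotent (Ellis–Numakura, Mathlib
`exists_idempotent_in_compact_subsemigroup`), necessarily `1`, whence `r⁻¹ = r⁻¹ · 1 ∈ closure {rⁿ : n ≥ 0} ⊆ R_tr`.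
So `a` or `1 − a` is a unit for every `a` (`isLocalRing_ring`), and `p`, of reduction `0`, is not a unit
(`natCast_mem_maximalIdeal`). [cite: Chenevier2014, §3, Ex. 3.7] (structure of trace algebras; the argument here is
elementary and self-contained).
-/

set_option linter.dupNamespace false
set_option autoImplicit false

noncomputable section

open scoped NumberField Matrix
open Filter Field IsDedekindDomain Topology
open Literature.NumberTheory.GaloisRepresentations Literature.NumberTheory.Automorphic
open Literature.NumberTheory.Automorphic.BigHeckeGLn

namespace Summit.Langlands.Langlands.Cruxes.ProModularOfGKBound.TwoLeafFern

namespace TraceHost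

variable {F : Type} [Field F] [NumberField F] {p : ℕ} [Fact p.Prime]
variable {ρ : FramedGaloisRep F (PadicAlgCl p) 2} {ρ₀ : absoluteGaloisGroup F →* GL (Fin 2) (Oint p)}

/-! ### The residue map and locality -/

/-- The `s`-coordinate of an element of `R_tr`, as an element of `O`. [folklore] -/
def evalO (s : LiftDatum p ρ ρ₀) : ring ρ ρ₀ →+* Oint p where
  toFun r := ⟨(r : Amb ρ ρ₀) s, (mem_Oint_iff _).2 (norm_apply_le_one r s)⟩
  map_one' := Subtype.ext rfl
  map_mul' _ _ := Subtype.ext rfl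
  map_zero' := Subtype.ext rfl
  map_add' _ _ := Subtype.ext rfl

/-- Unfolding lemma for `evalO`. [folklore] -/
@[simp] theorem coe_evalO (s : LiftDatum p ρ ρ₀) (r : ring ρ ρ₀) : (evalO s r : PadicAlgCl p) = (r : Amb ρ ρ₀) s := rfl

/-- The reduction `r ↦ r_s mod 𝔪_O` at the coordinate `s`. [folklore] -/
def residueAt (s : LiftDatum p ρ ρ₀) : ring ρ ρ₀ →+* IsLocalRing.ResidueField (Oint p) :=
  (IsLocalRing.residue (Oint p)).comp (evalO s)

/-- `residueAt s r = 0 ↔ ‖r_s‖ < 1`. [folklore] -/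
theorem residueAt_eq_zero_iff (s : LiftDatum p ρ ρ₀) (r : ring ρ ρ₀) :
    residueAt s r = 0 ↔ ‖(r : Amb ρ ρ₀) s‖ < 1 := by
  rw [residueAt, RingHom.comp_apply, IsLocalRing.residue_eq_zero_iff,
    mem_maximalIdeal_iff_norm_lt_one (fun x => mem_Oint_iff x)]
  rfl

/-- The reduction at `s` is locally constant: it is constant on the open set `‖r_s − r₀_s‖ < 1`. [folklore] -/
theorem residueAt_eq_of_norm_sub_lt (s : LiftDatum p ρ ρ₀) {r r₀ : ring ρ ρ₀}
    (h : ‖(r : Amb ρ ρ₀) s - (r₀ : Amb ρ ρ₀) s‖ < 1) : residueAt s r = residueAt s r₀ := by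
  rw [← sub_eq_zero, ← map_sub, residueAt_eq_zero_iff]
  exact h

/-- The reduction at `s` is continuous for the discrete topology on the residue field. [folklore] -/
theorem continuous_residueAt (s : LiftDatum p ρ ρ₀) :
    @Continuous _ _ _ (⊥ : TopologicalSpace (IsLocalRing.ResidueField (Oint p))) (residueAt s) := by
  letI : TopologicalSpace (IsLocalRing.ResidueField (Oint p)) := ⊥
  haveI : DiscreteTopology (IsLocalRing.ResidueField (Oint p)) := ⟨rfl⟩
  refine continuous_discrete_rng.2 fun b => ?_
  refine isOpen_iff_forall_mem_open.2 fun r₀ hr₀ => ?_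
  have hcont : Continuous fun r : ring ρ ρ₀ => (r : Amb ρ ρ₀) s :=
    (continuous_apply s).comp continuous_subtype_val
  refine ⟨{r | ‖(r : Amb ρ ρ₀) s - (r₀ : Amb ρ ρ₀) s‖ < 1}, fun r hr => ?_, ?_, by simp⟩
  · rw [Set.mem_preimage, Set.mem_singleton_iff, residueAt_eq_of_norm_sub_lt s hr]
    exact hr₀
  · exact isOpen_lt (continuous_norm.comp (hcont.sub continuous_const)) continuous_const

/-- On the generators the reduction does not depend on the coordinate (trace congruence of the lifts).
[folklore] -/
theorem residueAt_traceR (s s' : LiftDatum p ρ ρ₀) (g : absoluteGaloisGroup F) :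
    residueAt s (traceR g) = residueAt s' (traceR g) := by
  have key : ∀ t : LiftDatum p ρ ρ₀, residueAt t (traceR g) = IsLocalRing.residue (Oint p) (ρ₀ g).val.trace := by
    intro t
    rw [residueAt, RingHom.comp_apply, ← sub_eq_zero, ← map_sub, IsLocalRing.residue_eq_zero_iff]
    have he : evalO t (traceR g) = (t.model g).val.trace :=
      Subtype.ext (by rw [coe_evalO, coe_traceR]; exact t.trace_rep g)
    rw [he]
    exact t.trace_congr g
  rw [key, key]

/-- **The reduction is independent of the coordinate** on all of `R_tr` (ring maps agreeing on the generators
agree on the subring they generate, and by continuity — for the discrete topology on the residue field — on its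
closure). [folklore] -/
theorem residueAt_eq (s s' : LiftDatum p ρ ρ₀) (r : ring ρ ρ₀) : residueAt s r = residueAt s' r := by
  letI : TopologicalSpace (IsLocalRing.ResidueField (Oint p)) := ⊥
  haveI : DiscreteTopology (IsLocalRing.ResidueField (Oint p)) := ⟨rfl⟩
  have h1 : Set.EqOn (residueAt s) (residueAt s')
      (Subring.closure (Set.range (pseudochar (ρ := ρ) (ρ₀ := ρ₀) : absoluteGaloisGroup F → ring ρ ρ₀))) := by
    intro x hx
    refine Subring.closure_induction (fun z hz => ?_) (by simp) (by simp)
      (fun a b _ _ ha hb => by rw [map_add, map_add, ha, hb])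
      (fun a _ ha => by rw [map_neg, map_neg, ha])
      (fun a b _ _ ha hb => by rw [map_mul, map_mul, ha, hb]) hx
    obtain ⟨g, rfl⟩ := hz
    exact residueAt_traceR s s' g
  have h2 := h1.closure (continuous_residueAt s) (continuous_residueAt s')
  have hr : r ∈ closure (Subring.closure (Set.range (pseudochar (ρ := ρ) (ρ₀ := ρ₀) :
      absoluteGaloisGroup F → ring ρ ρ₀)) : Set (ring ρ ρ₀)) := by
    have := traces_dense (ρ := ρ) (ρ₀ := ρ₀)
    rw [Subring.ext_iff] at this
    exact (this r).2 (Subring.mem_top r)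
  exact h2 hr

/-- `residueAt s r ≠ 0` iff every coordinate of `r` has norm one. [folklore] -/
theorem residueAt_ne_zero_iff (s : LiftDatum p ρ ρ₀) (r : ring ρ ρ₀) :
    residueAt s r ≠ 0 ↔ ∀ t, ‖(r : Amb ρ ρ₀) t‖ = 1 := by
  constructor
  · intro h t
    rw [residueAt_eq s t, Ne, residueAt_eq_zero_iff, not_lt] at h
    exact le_antisymm (norm_apply_le_one r t) h
  · intro h h0
    rw [residueAt_eq_zero_iff, h s] at h0
    exact lt_irrefl _ h0

/-- **Coordinatewise units are units of `R_tr`.**  If every coordinate of `r ∈ R_tr` has norm one, then `r`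
is a unit of `R_tr`: the closure `K` of `{rⁿ : n ≥ 1}` in the compact `R_tr` is a compact subsemigroup, so
contains an idempotent (Ellis–Numakura, `exists_idempotent_in_compact_subsemigroup`), whose coordinates are
idempotents of norm one in a field, i.e. `1`; hence `1 ∈ K` and `r⁻¹ = r⁻¹·1 ∈ closure {rⁿ : n ≥ 0} ⊆ R_tr`.
[folklore] -/
theorem isUnit_of_forall_norm_eq_one (r : ring ρ ρ₀) (h : ∀ s, ‖(r : Amb ρ ρ₀) s‖ = 1) : IsUnit r := by
  -- the positive powers and their closure
  let P : Set (ring ρ ρ₀) := Set.range fun n : ℕ => r ^ (n + 1)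
  have hPmul : ∀ x ∈ P, ∀ y ∈ P, x * y ∈ P := by
    rintro _ ⟨a, rfl⟩ _ ⟨b, rfl⟩
    refine ⟨a + b + 1, ?_⟩
    change r ^ (a + b + 1 + 1) = r ^ (a + 1) * r ^ (b + 1)
    rw [← pow_add]
    congr 1
    omega
  let K : Set (ring ρ ρ₀) := closure P
  have hKmul : ∀ x ∈ K, ∀ y ∈ K, x * y ∈ K := by
    intro x hx y hy
    have hsub : P ×ˢ P ⊆ (fun q : ring ρ ρ₀ × ring ρ ρ₀ => q.1 * q.2) ⁻¹' K := by
      rintro ⟨a, b⟩ ⟨ha, hb⟩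
      exact subset_closure (hPmul a ha b hb)
    have hcl : closure (P ×ˢ P) ⊆ (fun q : ring ρ ρ₀ × ring ρ ρ₀ => q.1 * q.2) ⁻¹' K :=
      (isClosed_closure.preimage continuous_mul).closure_subset_iff.2 hsub
    have hxy : (x, y) ∈ closure (P ×ˢ P) := by
      rw [closure_prod_eq]
      exact ⟨hx, hy⟩
    exact hcl hxy
  have hKne : K.Nonempty := ⟨r ^ 1, subset_closure ⟨0, rfl⟩⟩
  have hKc : IsCompact K := isClosed_closure.isCompact
  obtain ⟨e, heK, hee⟩ := exists_idempotent_in_compact_subsemigroup (fun y => continuous_mul_const y) K hKne hKc hKmul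
  -- every element of `K` has coordinates of norm one; hence `e = 1`
  have hnorm : ∀ x ∈ K, ∀ s, ‖(x : Amb ρ ρ₀) s‖ = 1 := by
    have hclosed : IsClosed {x : ring ρ ρ₀ | ∀ s, ‖(x : Amb ρ ρ₀) s‖ = 1} := by
      have : {x : ring ρ ρ₀ | ∀ s, ‖(x : Amb ρ ρ₀) s‖ = 1} = ⋂ s, {x : ring ρ ρ₀ | ‖(x : Amb ρ ρ₀) s‖ = 1} := by
        ext; simp
      rw [this]
      exact isClosed_iInter fun s => isClosed_eq
        (continuous_norm.comp ((continuous_apply s).comp continuous_subtype_val)) continuous_const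
    have hP : P ⊆ {x : ring ρ ρ₀ | ∀ s, ‖(x : Amb ρ ρ₀) s‖ = 1} := by
      rintro _ ⟨n, rfl⟩ s
      change ‖((r ^ (n + 1) : ring ρ ρ₀) : Amb ρ ρ₀) s‖ = 1
      rw [SubmonoidClass.coe_pow, Pi.pow_apply, norm_pow, h s, one_pow]
    exact fun x hx => (hclosed.closure_subset_iff.2 hP) hx
  have he1 : e = 1 := by
    apply Subtype.ext
    funext s
    have h1 : ‖(e : Amb ρ ρ₀) s‖ = 1 := hnorm e heK s
    have hne : (e : Amb ρ ρ₀) s ≠ 0 := fun h0 => by rw [h0, norm_zero] at h1; exact zero_ne_one h1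
    have hmul : (e : Amb ρ ρ₀) s * (e : Amb ρ ρ₀) s = (e : Amb ρ ρ₀) s := by
      have := congrArg (fun x : ring ρ ρ₀ => (x : Amb ρ ρ₀) s) hee
      simpa using this
    exact (mul_eq_left₀ hne).1 hmul
  -- the coordinatewise inverse lies in `R_tr`
  let b : Amb ρ ρ₀ := fun s => ((r : Amb ρ ρ₀) s)⁻¹
  have hrs : ∀ s, (r : Amb ρ ρ₀) s ≠ 0 := fun s h0 => by
    have := h s; rw [h0, norm_zero] at this; exact zero_ne_one this
  have hbr : b * (r : Amb ρ ρ₀) = 1 := funext fun s => inv_mul_cancel₀ (hrs s)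
  have h1K : (1 : Amb ρ ρ₀) ∈ closure ((ring ρ ρ₀).subtype '' P) := by
    have := map_mem_closure continuous_subtype_val heK (fun x hx => Set.mem_image_of_mem (ring ρ ρ₀).subtype hx)
    rw [he1] at this
    exact this
  have hb : b ∈ ring ρ ρ₀ := by
    have hmem : b * 1 ∈ closure ((fun y => b * y) '' ((ring ρ ρ₀).subtype '' P)) :=
      map_mem_closure (continuous_const_mul b) h1K (fun y hy => Set.mem_image_of_mem _ hy)
    rw [mul_one] at hmem
    have hsub : (fun y => b * y) '' ((ring ρ ρ₀).subtype '' P) ⊆ ring ρ ρ₀ := by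
      rintro _ ⟨_, ⟨_, ⟨n, rfl⟩, rfl⟩, rfl⟩
      change b * ((r ^ (n + 1) : ring ρ ρ₀) : Amb ρ ρ₀) ∈ ring ρ ρ₀
      rw [SubmonoidClass.coe_pow, pow_succ', ← mul_assoc, hbr, one_mul, ← SubmonoidClass.coe_pow]
      exact (r ^ n).2
    exact ((Subring.isClosed_topologicalClosure _).closure_subset_iff.2 hsub) hmem
  refine ⟨⟨r, ⟨b, hb⟩, Subtype.ext ?_, Subtype.ext ?_⟩, rfl⟩
  · change (r : Amb ρ ρ₀) * b = 1
    rw [mul_comm]; exact hbr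
  · exact hbr

variable (ρ ρ₀) in
/-- `R_tr` is non-trivial as soon as there is a lift. [folklore] -/
theorem nontrivial_ring [Nonempty (LiftDatum p ρ ρ₀)] : Nontrivial (ring ρ ρ₀) := by
  obtain ⟨s⟩ := ‹Nonempty (LiftDatum p ρ ρ₀)›
  refine ⟨⟨0, 1, fun h => ?_⟩⟩
  have := congrArg (fun x : ring ρ ρ₀ => (x : Amb ρ ρ₀) s) h
  simp at this

/-- **`R_tr` is a local ring**: an element is a unit iff its (coordinate-independent) reduction is non-zero,
and the reduction of `1 − a` is `1` when that of `a` vanishes. [folklore] -/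
theorem isLocalRing_ring [Nonempty (LiftDatum p ρ ρ₀)] : IsLocalRing (ring ρ ρ₀) := by
  haveI := nontrivial_ring ρ ρ₀
  obtain ⟨s⟩ := ‹Nonempty (LiftDatum p ρ ρ₀)›
  refine IsLocalRing.of_isUnit_or_isUnit_one_sub_self fun a => ?_
  by_cases ha : residueAt s a = 0
  · right
    refine isUnit_of_forall_norm_eq_one _ ((residueAt_ne_zero_iff s _).1 ?_)
    rw [map_sub, map_one, ha, sub_zero]
    exact one_ne_zero
  · exact Or.inl (isUnit_of_forall_norm_eq_one _ ((residueAt_ne_zero_iff s _).1 ha))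

/-- Units of `R_tr` have non-zero reduction. [folklore] -/
theorem residueAt_ne_zero_of_isUnit (s : LiftDatum p ρ ρ₀) {u : ring ρ ρ₀} (hu : IsUnit u) : residueAt s u ≠ 0 :=
  (hu.map (residueAt s)).ne_zero

/-- **`p` lies in the maximal ideal of `R_tr`** (its reduction vanishes). [folklore] -/
theorem natCast_mem_maximalIdeal [Nonempty (LiftDatum p ρ ρ₀)] :
    letI := isLocalRing_ring (ρ := ρ) (ρ₀ := ρ₀)
    ((p : ℕ) : ring ρ ρ₀) ∈ IsLocalRing.maximalIdeal (ring ρ ρ₀) := by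
  letI := isLocalRing_ring (ρ := ρ) (ρ₀ := ρ₀)
  obtain ⟨s⟩ := ‹Nonempty (LiftDatum p ρ ρ₀)›
  rw [IsLocalRing.mem_maximalIdeal, mem_nonunits_iff]
  intro hu
  refine residueAt_ne_zero_of_isUnit s hu ((residueAt_eq_zero_iff s _).2 ?_)
  change ‖((p : ℕ) : Amb ρ ρ₀) s‖ < 1
  rw [Pi.natCast_apply]
  have h1 : ((p : ℕ) : PadicAlgCl p) = ((p : ℚ_[p]) : PadicAlgCl p) := by
    rw [map_natCast]
  rw [h1, PadicAlgCl.norm_extends, Padic.norm_p]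
  exact inv_lt_one_of_one_lt₀ (by exact_mod_cast (Fact.out : p.Prime).one_lt)

end TraceHost

/-- **Sub-goal `stub_traceHostLocal` of `stub_host`**: the trace algebra of the lifts of `ρ` is a LOCAL ring
(as soon as there is a lift; `TraceHost.isLocalRing_ring`), and then `p` lies in its maximal ideal
(`TraceHost.natCast_mem_maximalIdeal`). [folklore] -/
theorem stub_traceHostLocal : ∀ (F : Type) [Field F] [NumberField F] (p : ℕ) [Fact p.Prime] (ρ : FramedGaloisRep F (PadicAlgCl p) 2) (ρ₀ : absoluteGaloisGroup F →* GL (Fin 2) (TraceHost.Oint p)), Nonempty (TraceHost.LiftDatum p ρ ρ₀) → IsLocalRing (TraceHost.ring ρ ρ₀) :=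
  fun _ _ _ _ _ _ _ h => @TraceHost.isLocalRing_ring _ _ _ _ _ _ _ h

end Summit.Langlands.Langlands.Cruxes.ProModularOfGKBound.TwoLeafFern

end
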